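import Summits.QuantumFields.YangMills.Theorems.EquipartitionCriticalityFreeEnergyLogCoefficientExpChartBasic
import Summits.QuantumFields.YangMills.Theorems.BalabanLadderUVNonSUNRecEmlAverage
import Literature.MathematicalPhysics.QuantumFieldTheory.Balaban1983to89.HaarExponentialChartMeasure
import Literature.MathematicalPhysics.QuantumFieldTheory.Balaban1983to89.HaarDensityEvenClosedSubgroup
import HarnessLib

/-!
# Second-order exponential chart package, part (c): Haar measure = `c_H · J · Lebesgue` on chart balls,
# with a continuous Jacobian `J = 1 + O(|a|²)`

Support file for the stub `stub_expChartPackage2 : ColdBoxAllGroups.ExpChartPackage2` (support item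
stmt-QuantumFields-22893, shared stub D2 of crux `BoxFloorAllGroups` = stmt-QuantumFields-22254, line `birth`,
route `ColdBoxAllGroups` of `QuantumFields/YangMills`).

For a compact group `G` with a faithful continuous unitary lattice representation `r : LatticeRep G` and the
tree's exponential chart `ψ = expChart r.ρ : ℝ^D → G` (`FreeEnergyLogCoefficient.expChart/lieIso/dimE`), we
prove `exists_haar_expChart_eq`: there are `r₂, C₂, c_H > 0` and a continuous `J : ℝ^D → ℝ` with
`|J a − 1| ≤ C₂‖a‖²` on `‖a‖ ≤ r₂` such that for every `0 < s ≤ r₂` and every measurable `F ≥ 0`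
`∫_{ψ(B̄(0,s))} F dσ = c_H ∫_{B̄(0,s)} F(ψ a) J(a) da` (`σ` = the Haar probability measure, `da` = Lebesgue
measure on `ℝ^D`).

Method: the Literature's Helgason Theorem 1.14 at measure level for a compact group faithfully represented on
a log-charted carrier (`HaarExponentialChart.IsChartRep.exists_radius_lintegral_haar_window_eq_det`, applied
to the log-chart `UVNonSUNRec.chart r` of the closed subgroup `r(G) ⊆ M_N(ℂ)`), transported along the
linear isomorphism `a ↦ lieIso r.ρ a : ℝ^D ≃ 𝔤`; `J a = det((1 − e^{−ad X})/ad X)|_𝔤`, `X = lieIso a`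
(`B13HaarSigmaJacobian.jac`), which is real-analytic (`analyticAt_det_jac_real`) and even
(`HaarDensityEvenClosedSubgroup.det_jac_neg`, `𝔤 ⊆ 𝔲(N)` is unimodular), whence `J = 1 + O(|a|²)`.

References: S. Helgason, *Groups and Geometric Analysis* (2000) Ch. I §1 Thm. 1.14; M. Sepanski, *Compact Lie
Groups* (2007) §1.3; S. Chatterjee, arXiv:1602.01222 §11.  No claim about the Yang–Mills mass gap is made here
(support lemma of a RECORD-label rung R2xi-G line).
-/

noncomputable section

open scoped Matrix Matrix.Norms.L2Operator ENNReal NNReal Topology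
open NormedSpace (exp)
open MeasureTheory Set Filter Metric
open Literature.MathematicalPhysics.QuantumFieldTheory
open Literature.MathematicalPhysics.QuantumFieldTheory.Balaban1983to89
open Literature.MathematicalPhysics.QuantumFieldTheory.Balaban1983to89.HaarExponentialChart
open Literature.MathematicalPhysics.QuantumLattice (matrixLieAlgebra matrixLieAlgebra_le_skewAdjoint)

namespace Summit.QuantumFields.YangMills.Theorems.ColdBoxAllGroups.ExpChart2

open Summit.QuantumFields.YangMills.Theorems.FreeEnergyLogCoefficient (dimE lieIso expChart lieIso_mem
  exists_lieIso_eq rho_expChart)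
open Asymptotics
open Summit.QuantumFields.YangMills.Theorems.UVNonSUNRec (chart)

variable {G : Type} [Group G] [TopologicalSpace G] [CompactSpace G] (r : LatticeRep G)

/-! ### The log-chart of `r(G)` and the route's chart coordinates -/

/-- `r` is a faithful continuous representation onto the carrier `r(G)` of the log-chart `chart r`.
[cite: Helgason2000, Ch. I §1 Thm. 1.14 p. 96] -/
theorem isChartRep_chart : IsChartRep (chart r) r.ρ where
  continuous := r.continuous
  injective := r.injective
  range_eq := rfl

/-- The Lie algebra of `chart r` is `ad`-stable. [cite: Hall2015, Thm. 3.20] -/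
theorem chart_hlie : ∀ x ∈ (chart r).lie, ∀ y ∈ (chart r).lie, x * y - y * x ∈ (chart r).lie :=
  fun _ hx _ hy => (chart r).mul_sub_mul_mem_lie hx hy

/-- The Lie algebra of `chart r` is the tree's `matrixLieAlgebra (range r.ρ)`. [cite: Hall2015, Thm. 3.20] -/
theorem chart_lie_eq : (chart r).lie = matrixLieAlgebra (Set.range r.ρ) :=
  (chart r).lie_eq_matrixLieAlgebra

/-- The Lie algebra of `chart r` consists of skew-Hermitian matrices. [cite: Hall2015, Prop. 3.24] -/
theorem chart_hskew : ∀ X ∈ (chart r).lie, star X = -X := fun X hX => by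
  rw [chart_lie_eq] at hX
  exact skewAdjoint.mem_iff.1 (matrixLieAlgebra_le_skewAdjoint r.range_subset_unitaryGroup hX)

/-- `lieIso r.ρ a` lies in the Lie algebra of `chart r`. [folklore] -/
theorem lieIso_mem_chart_lie (a : EuclideanSpace ℝ (Fin (dimE r.ρ))) : lieIso r.ρ a ∈ (chart r).lie := by
  rw [chart_lie_eq]; exact lieIso_mem r.ρ a

omit [CompactSpace G] in
/-- `lieIso` preserves norms (Euclidean to Frobenius), restated with the Frobenius norm explicit. [folklore] -/
theorem frobenius_norm_lieIso (a : EuclideanSpace ℝ (Fin (dimE r.ρ))) :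
    @norm _ Matrix.frobeniusSeminormedAddCommGroup.toNorm (lieIso r.ρ a) = ‖a‖ :=
  Summit.QuantumFields.YangMills.Theorems.FreeEnergyLogCoefficient.norm_lieIso r.ρ a

/-- **The chart coordinates as a linear isomorphism `ℝ^D ≃ 𝔤`**: there is a continuous linear equivalence
`e : ℝ^D ≃ (chart r).lie` with `e a = lieIso r.ρ a`. [folklore] -/
theorem exists_coordEquiv : ∃ e : EuclideanSpace ℝ (Fin (dimE r.ρ)) ≃L[ℝ] (chart r).lie,
    ∀ a, ((e a : (chart r).lie) : Matrix (Fin r.N) (Fin r.N) ℂ) = lieIso r.ρ a := by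
  -- the linear map underlying `lieIso` (its codomain carries the Frobenius norm, made explicit here)
  let L : EuclideanSpace ℝ (Fin (dimE r.ρ)) →ₗ[ℝ] Matrix (Fin r.N) (Fin r.N) ℂ :=
    @LinearIsometry.toLinearMap ℝ ℝ _ _ (RingHom.id ℝ) _ _ _ Matrix.frobeniusSeminormedAddCommGroup _ _
      (lieIso r.ρ)
  have hL : ∀ a, L a = lieIso r.ρ a := fun a => rfl
  let f : EuclideanSpace ℝ (Fin (dimE r.ρ)) →ₗ[ℝ] (chart r).lie :=
    LinearMap.codRestrict (chart r).lie L (fun a => by rw [hL]; exact lieIso_mem_chart_lie r a)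
  have hf : ∀ a, ((f a : (chart r).lie) : Matrix (Fin r.N) (Fin r.N) ℂ) = lieIso r.ρ a := fun a => rfl
  have hinj : Function.Injective f := fun a b hab => by
    have h1 : lieIso r.ρ (a - b) = 0 := by rw [← hL, map_sub, hL, hL, ← hf, ← hf, hab, sub_self]
    have h2 := frobenius_norm_lieIso r (a - b)
    rw [h1] at h2
    have h3 : ‖a - b‖ = 0 := by
      rw [← h2]
      exact @norm_zero _ Matrix.frobeniusSeminormedAddCommGroup.toSeminormedAddGroup
    exact sub_eq_zero.1 (norm_eq_zero.1 h3)
  have hsurj : Function.Surjective f := fun X => by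
    have hX : (X : Matrix (Fin r.N) (Fin r.N) ℂ) ∈ matrixLieAlgebra (Set.range r.ρ) := by
      rw [← chart_lie_eq]; exact X.2
    obtain ⟨a, ha⟩ := exists_lieIso_eq r.ρ r.mem_unitary hX
    exact ⟨a, Subtype.ext (by rw [hf, ha])⟩
  exact ⟨(LinearEquiv.ofBijective f ⟨hinj, hsurj⟩).toContinuousLinearEquiv, fun a => hf a⟩

/-- The two exponential charts agree: `Θ X = ψ a` whenever `X = lieIso a`. [cite: arXiv160201222, §11] -/
theorem expChart_eq_of_coe_eq {X : (chart r).lie} {a : EuclideanSpace ℝ (Fin (dimE r.ρ))}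
    (h : ((X : (chart r).lie) : Matrix (Fin r.N) (Fin r.N) ℂ) = lieIso r.ρ a) :
    (isChartRep_chart r).expChart X = expChart r.ρ a := by
  apply r.injective
  rw [(isChartRep_chart r).rho_expChart, h]
  exact (rho_expChart r.ρ r.continuous a).symm

/-! ### An even analytic function is `f(0) + O(‖x‖²)` -/

/-- For `f : E → ℝ` analytic at `0` and even, `|f x − f 0| ≤ C‖x‖²` near `0`: the linear Taylor term
cancels between `x` and `−x`. [folklore] -/
theorem exists_sq_bound_of_analyticAt_even {E : Type*} [NormedAddCommGroup E] [NormedSpace ℝ E]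
    {f : E → ℝ} (hf : AnalyticAt ℝ f 0) (heven : ∀ x, f (-x) = f x) :
    ∃ C ε : ℝ, 0 < C ∧ 0 < ε ∧ ∀ x : E, ‖x‖ < ε → |f x - f 0| ≤ C * ‖x‖ ^ 2 := by
  obtain ⟨p, hp⟩ := hf
  have h1 := hp.isBigO_sub_partialSum_pow 2
  have hneg : Tendsto (fun y : E => -y) (𝓝 0) (𝓝 0) := by
    simpa using (continuous_neg : Continuous fun y : E => -y).tendsto 0
  have h2 := h1.comp_tendsto hneg
  -- the partial sums at `y` and `-y` add up to `2 f 0`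
  have hP : ∀ y : E, p.partialSum 2 y + p.partialSum 2 (-y) = 2 * f 0 := fun y => by
    have hc0 : ∀ v : Fin 0 → E, p 0 v = f 0 := fun v => hp.coeff_zero v
    have hc1 : p 1 (fun _ : Fin 1 => -y) = -(p 1 fun _ : Fin 1 => y) := by
      have : (fun _ : Fin 1 => -y) = fun i : Fin 1 => (fun _ : Fin 1 => (-1 : ℝ)) i • (fun _ : Fin 1 => y) i := by
        ext i; simp
      rw [this, (p 1).map_smul_univ]
      simp
    simp only [FormalMultilinearSeries.partialSum, Finset.sum_range_succ, Finset.sum_range_zero, zero_add,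
      hc0, hc1]
    ring
  have h3 : (fun y : E => 2 * (f y - f 0)) =O[𝓝 0] fun y : E => ‖y‖ ^ 2 := by
    have h2' : (fun y : E => f (0 + -y) - p.partialSum 2 (-y)) =O[𝓝 0] fun y : E => ‖y‖ ^ 2 :=
      h2.congr_right fun y => by simp [norm_neg]
    refine (h1.add h2').congr_left fun y => ?_
    simp only [zero_add]
    have := hP y
    rw [heven] ; linarith
  obtain ⟨c, hc, hcw⟩ := h3.exists_pos
  obtain ⟨ε, hε, hball⟩ := Metric.eventually_nhds_iff.1 hcw.bound
  refine ⟨c / 2, ε, by positivity, hε, fun x hx => ?_⟩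
  have h := hball (by rwa [dist_zero_right])
  have hx2 : ‖‖x‖ ^ 2‖ = ‖x‖ ^ 2 := by rw [Real.norm_eq_abs, abs_of_nonneg (by positivity)]
  rw [hx2, Real.norm_eq_abs, abs_mul, abs_two] at h
  linarith

/-! ### Haar measure in the route's chart coordinates -/

variable [IsTopologicalGroup G] [MeasurableSpace G] [BorelSpace G]

/-- The Haar probability measure of the compact group `G` is a Haar measure in Mathlib's sense. [folklore] -/
theorem isHaarMeasure_haarProbability : (haarProbability G).IsHaarMeasure := by
  unfold haarProbability
  infer_instance

/-- **(c) Haar = `c_H · J · Lebesgue` on chart balls, `J = 1 + O(|a|²)` continuous.**  For a compact group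
`G` with a faithful continuous unitary representation `r` there are `r₂, C₂, c_H > 0` and a continuous
`J : ℝ^D → ℝ` with `|J a − 1| ≤ C₂‖a‖²` for `‖a‖ ≤ r₂`, such that for `0 < s ≤ r₂` and measurable `F ≥ 0`
`∫_{ψ(B̄(0,s))} F dσ = c_H · ∫_{B̄(0,s)} F(ψ a) J(a) da` — Helgason's Theorem 1.14 (13) in the coordinates
`a ↦ lieIso a` of the exponential chart, `J(a) = det((1 − e^{−ad X})/ad X)|_𝔤`, `X = lieIso a`.
[cite: Helgason2000, Ch. I §1 Thm. 1.14 p. 96] [cite: Sepanski2007, §1.3] -/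
theorem exists_haar_expChart_eq :
    ∃ (r₂ C₂ cH : ℝ), 0 < r₂ ∧ 0 < C₂ ∧ 0 < cH ∧
      ∃ J : EuclideanSpace ℝ (Fin (dimE r.ρ)) → ℝ, Continuous J ∧
        (∀ a, ‖a‖ ≤ r₂ → |J a - 1| ≤ C₂ * ‖a‖ ^ 2) ∧
        ∀ s : ℝ, 0 < s → s ≤ r₂ → ∀ F : G → ℝ≥0∞, Measurable F →
          ∫⁻ g in expChart r.ρ '' Metric.closedBall 0 s, F g ∂(haarProbability G) =
            ENNReal.ofReal cH * ∫⁻ a in Metric.closedBall (0 : EuclideanSpace ℝ (Fin (dimE r.ρ))) s,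
              F (expChart r.ρ a) * ENNReal.ofReal (J a) := by
  classical
  letI : MeasurableSpace (chart r).lie := borel _
  haveI : BorelSpace (chart r).lie := ⟨rfl⟩
  haveI := isHaarMeasure_haarProbability (G := G)
  have hIC := isChartRep_chart r
  have hlie := chart_hlie r
  obtain ⟨e, he⟩ := exists_coordEquiv r
  -- Lebesgue measure transported to `𝔤`
  let η : Measure (chart r).lie := Measure.map (fun a => e a) volume
  haveI hη : η.IsAddHaarMeasure := e.isAddHaarMeasure_map volume
  -- Helgason's theorem on a window `Θ(B(0,s₁))`
  obtain ⟨s₁, hs₁, hs₁C, hwin⟩ :=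
    hIC.exists_radius_lintegral_haar_window_eq_det hlie η (haarProbability G)
  -- the Jacobian `f X = det jac X` is analytic, even, `f 0 = 1`
  set f : (chart r).lie → ℝ := fun X => LinearMap.det (B13HaarSigmaJacobian.jac hlie X :
    (chart r).lie →ₗ[ℝ] (chart r).lie) with hfdef
  have hf0 : f 0 = 1 := B13HaarSigmaJacobian.det_jac_zero hlie
  have hfan : AnalyticAt ℝ f 0 :=
    B13HaarSigmaJacobian.analyticAt_det_jac_real hlie (Module.finBasis ℝ (chart r).lie) 0
  have hfeven : ∀ X, f (-X) = f X := fun X =>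
    HaarDensityEvenClosedSubgroup.det_jac_neg hlie (chart_hskew r) X
  have hfcont : Continuous f := HaarExponentialChart.continuous_det_jac hlie
  obtain ⟨C, ε, hC, hε, hfb⟩ := exists_sq_bound_of_analyticAt_even hfan hfeven
  -- operator norm of the coordinate map
  set T : EuclideanSpace ℝ (Fin (dimE r.ρ)) →L[ℝ] (chart r).lie := e.toContinuousLinearMap with hTdef
  have hT0 : 0 ≤ ‖T‖ := norm_nonneg T
  set M : ℝ := ‖T‖ + 1 with hMdef
  have hM : 0 < M := by positivity
  have heM : ∀ a, ‖e a‖ ≤ M * ‖a‖ := fun a => by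
    have h : ‖e a‖ ≤ ‖T‖ * ‖a‖ := T.le_opNorm a
    exact h.trans (by nlinarith [norm_nonneg a])
  -- the constant `σ₀`
  set σ₀ : ℝ≥0∞ := haarProbability G (hIC.window s₁) /
    (∫⁻ X in Metric.ball 0 s₁, HaarExponentialChart.jacDensity hlie X ∂η) with hσ₀
  have hden_ne_zero : ∫⁻ X in Metric.ball 0 s₁, HaarExponentialChart.jacDensity hlie X ∂η ≠ 0 := by
    rw [← hIC.chartMeasure_window hlie η hs₁C]
    exact hIC.chartMeasure_window_ne_zero hlie η hs₁ hs₁C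
  have hden_ne_top : ∫⁻ X in Metric.ball 0 s₁, HaarExponentialChart.jacDensity hlie X ∂η ≠ ⊤ := by
    rw [← hIC.chartMeasure_window hlie η hs₁C]
    exact (hIC.chartMeasure_window_lt_top hlie η hs₁C).ne
  have hnum_ne_zero : haarProbability G (hIC.window s₁) ≠ 0 :=
    ((hIC.isOpen_window hs₁C).measure_pos _ ⟨1, hIC.one_mem_window hs₁⟩).ne'
  have hnum_ne_top : haarProbability G (hIC.window s₁) ≠ ⊤ := measure_ne_top _ _
  have hσ₀0 : σ₀ ≠ 0 := (ENNReal.div_pos_iff.2 ⟨hnum_ne_zero, hden_ne_top⟩).ne'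
  have hσ₀top : σ₀ ≠ ⊤ := ENNReal.div_ne_top hnum_ne_top hden_ne_zero
  -- the radius
  set r₂ : ℝ := min (ε / (2 * M)) (s₁ / (2 * M)) with hr₂
  have hr₂pos : 0 < r₂ := lt_min (by positivity) (by positivity)
  have hr₂ε : ∀ a : EuclideanSpace ℝ (Fin (dimE r.ρ)), ‖a‖ ≤ r₂ → ‖e a‖ < ε := fun a ha => by
    have h1 : M * ‖a‖ ≤ M * (ε / (2 * M)) := mul_le_mul_of_nonneg_left (ha.trans (min_le_left _ _)) hM.le
    have h2 : M * (ε / (2 * M)) = ε / 2 := by field_simp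
    linarith [heM a]
  have hr₂s : ∀ a : EuclideanSpace ℝ (Fin (dimE r.ρ)), ‖a‖ ≤ r₂ → ‖e a‖ < s₁ := fun a ha => by
    have h1 : M * ‖a‖ ≤ M * (s₁ / (2 * M)) := mul_le_mul_of_nonneg_left (ha.trans (min_le_right _ _)) hM.le
    have h2 : M * (s₁ / (2 * M)) = s₁ / 2 := by field_simp
    linarith [heM a]
  refine ⟨r₂, C * M ^ 2, σ₀.toReal, hr₂pos, by positivity, ENNReal.toReal_pos hσ₀0 hσ₀top,
    fun a => f (e a), hfcont.comp e.continuous, fun a ha => ?_, fun s hs hsr F hF => ?_⟩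
  · -- `|J a − 1| ≤ C M² ‖a‖²`
    have h := hfb (e a) (hr₂ε a ha)
    rw [hf0] at h
    refine h.trans ?_
    have := heM a
    have h2 : ‖e a‖ ^ 2 ≤ (M * ‖a‖) ^ 2 := pow_le_pow_left₀ (norm_nonneg _) this 2
    nlinarith
  · -- the integral identity
    haveI : T2Space G := hIC.isClosedEmbedding.isEmbedding.t2Space
    set S := expChart r.ρ '' Metric.closedBall 0 s with hSdef
    have hΘe : ∀ a, hIC.expChart (e a) = expChart r.ρ a := fun a => expChart_eq_of_coe_eq r (he a)
    have hSsub : S ⊆ hIC.window s₁ := by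
      rintro _ ⟨a, ha, rfl⟩
      rw [Metric.mem_closedBall, dist_zero_right] at ha
      exact ⟨e a, mem_ball_zero_iff.2 (hr₂s a (ha.trans hsr)), hΘe a⟩
    have hScpt : IsCompact S := (isCompact_closedBall _ _).image
      (Summit.QuantumFields.YangMills.Theorems.FreeEnergyLogCoefficient.continuous_expChart r.ρ r.continuous
        r.injective)
    have hSmeas : MeasurableSet S := hScpt.isClosed.measurableSet
    -- (1) move to the window with an indicator
    have h1 : ∫⁻ g in S, F g ∂(haarProbability G) =
        ∫⁻ g in hIC.window s₁, S.indicator F g ∂(haarProbability G) := by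
      rw [lintegral_indicator hSmeas, Measure.restrict_restrict hSmeas, Set.inter_eq_left.2 hSsub]
    -- (2) Helgason on the window
    have hFi : Measurable (S.indicator F) := hF.indicator hSmeas
    have h2 := (hwin s₁ hs₁ le_rfl hFi).2
    -- (3) transport `η = e_* Lebesgue`
    have hΦ : Measurable fun X : (chart r).lie =>
        S.indicator F (hIC.expChart X) * ENNReal.ofReal (f X) :=
      (hFi.comp (hIC.measurable_expChart)).mul (hfcont.measurable.ennreal_ofReal)
    have h3 : ∫⁻ X in Metric.ball 0 s₁, S.indicator F (hIC.expChart X) * ENNReal.ofReal (f X) ∂η =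
        ∫⁻ a in (fun a => e a) ⁻¹' Metric.ball 0 s₁,
          S.indicator F (hIC.expChart (e a)) * ENNReal.ofReal (f (e a)) ∂volume :=
      setLIntegral_map measurableSet_ball hΦ e.continuous.measurable
    -- (4) pointwise identification on `e ⁻¹' B(0,s₁)`
    have h4 : ∀ a ∈ (fun a => e a) ⁻¹' Metric.ball (0 : (chart r).lie) s₁,
        S.indicator F (hIC.expChart (e a)) * ENNReal.ofReal (f (e a)) =
          (Metric.closedBall (0 : EuclideanSpace ℝ (Fin (dimE r.ρ))) s).indicator
            (fun a => F (expChart r.ρ a) * ENNReal.ofReal (f (e a))) a := by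
      intro a ha
      rw [Set.mem_preimage, mem_ball_zero_iff] at ha
      by_cases hmem : a ∈ Metric.closedBall (0 : EuclideanSpace ℝ (Fin (dimE r.ρ))) s
      · rw [Set.indicator_of_mem hmem, hΘe a, Set.indicator_of_mem (Set.mem_image_of_mem _ hmem)]
      · rw [Set.indicator_of_notMem hmem, Set.indicator_of_notMem, zero_mul]
        rintro ⟨a', ha', hEq⟩
        rw [← hΘe a'] at hEq
        rw [Metric.mem_closedBall, dist_zero_right] at ha'
        have hinj := hIC.injOn_expChart hs₁C (mem_ball_zero_iff.2 (hr₂s a' (ha'.trans hsr)))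
          (mem_ball_zero_iff.2 ha) hEq
        have : a' = a := e.injective hinj
        rw [← this] at hmem
        exact hmem (by rwa [Metric.mem_closedBall, dist_zero_right])
    have hsub' : Metric.closedBall (0 : EuclideanSpace ℝ (Fin (dimE r.ρ))) s ⊆
        (fun a => e a) ⁻¹' Metric.ball (0 : (chart r).lie) s₁ := fun a ha => by
      rw [Metric.mem_closedBall, dist_zero_right] at ha
      exact mem_ball_zero_iff.2 (hr₂s a (ha.trans hsr))
    have h5 : ∫⁻ a in (fun a => e a) ⁻¹' Metric.ball 0 s₁,
          S.indicator F (hIC.expChart (e a)) * ENNReal.ofReal (f (e a)) ∂volume =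
        ∫⁻ a in Metric.closedBall (0 : EuclideanSpace ℝ (Fin (dimE r.ρ))) s,
          F (expChart r.ρ a) * ENNReal.ofReal (f (e a)) := by
      rw [setLIntegral_congr_fun (measurableSet_ball.preimage e.continuous.measurable) h4,
        lintegral_indicator measurableSet_closedBall, Measure.restrict_restrict measurableSet_closedBall,
        Set.inter_eq_left.2 hsub']
    rw [h1, h2, h3, h5, ENNReal.ofReal_toReal hσ₀top]

end Summit.QuantumFields.YangMills.Theorems.ColdBoxAllGroups.ExpChart2

end
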